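import Summits.ABC.ABC.Theses.FeketeScales

/-!
# Sketch — crux-ideate `stmt-ABC-2161` (`SparseGoodScales`), ideator 1, round 1

First lemmas for the idea card `radical-lacunarity-split` (tower/density split of the crux):

* `PolyABC` — polynomial abc, LITERALLY the conclusion of the sibling route item
  `PolynomialAbcOfSubmult` (stmt-ABC-2163), hence owed by the route's rank-2 crux anyway
  (`polyABC_of_route`).
* `RadicalLacunarity` — the residual, placement-only statement: for every `δ > 0` and every window
  exponent `l ∈ (0,1)` there are arbitrarily large `Y` such that NO abc triple of quality `> 1+δ`
  has its radical in the window `(Y^l, Y]`.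
* `sparseGoodScales_of` — PROVED here: `PolyABC → RadicalLacunarity → SparseGoodScales`
  (towers of unbounded quality are discharged by the polynomial bound below the window, density by
  lacunarity inside it).
* `radicalLacunarity_top_of_sparseGoodScales` — PROVED here: the converse for THIN top windows
  (`l = (1+δ'')/(1+δ)` close to `1`): lacunarity of thin top windows is NECESSARY for the crux.
* `abc_of_summable_shadows` — the FIRST-MOMENT WALL (PROVED here): if for every `δ` the
  `δ`-shadow lengths `(log c − (1+δ) log rad)⁺` are summable over all abc triples then `ABC` itself
  follows; so no union-bound / exceptional-set-counting proof of the crux can be cheaper than `ABC`.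
-/

namespace Summit.ABC.ABC.Cruxes.SparseGoodScales.RadicalLacunaritySplit

open Literature.NumberTheory.DiophantineGeometry

/-- Polynomial abc (weak abc with SOME exponent): verbatim the conclusion of the sibling item
`Summit.ABC.ABC.Theses.FeketeScales.PolynomialAbcOfSubmult`. -/
def PolyABC : Prop :=
  ∃ A C : ℝ, ∀ a b c : ℕ, IsABCTriple a b c → (c : ℝ) ≤ C * ((rad a b c : ℕ) : ℝ) ^ A

/-- Radical lacunarity of the `(1+δ)`-bad set: every window `(Y^l, Y]` of radicals is, for
arbitrarily large `Y`, free of abc triples of quality `> 1 + δ`. -/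
def RadicalLacunarity : Prop :=
  ∀ δ : ℝ, 0 < δ → ∀ l : ℝ, 0 < l → l < 1 → ∀ N : ℕ, ∃ Y : ℕ, N ≤ Y ∧
    ∀ a b c : ℕ, IsABCTriple a b c → (Y : ℝ) ^ l < ((rad a b c : ℕ) : ℝ) → rad a b c ≤ Y →
      (c : ℝ) ≤ ((rad a b c : ℕ) : ℝ) ^ (1 + δ)

/-- In-route supply of the polynomial bound: rank-2 crux + item stmt-ABC-2163 + abc.S25. -/
theorem polyABC_of_route (h₁ : Theses.FeketeScales.ScaleSubmultiplicativity)
    (h₂ : Theses.FeketeScales.PolynomialAbcOfSubmult)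
    (h₃ : finite_setOf_isABCTriple_primeFactors_subset) : PolyABC :=
  h₂ h₁ h₃

theorem one_le_rad_real (a b c : ℕ) : (1 : ℝ) ≤ ((rad a b c : ℕ) : ℝ) := by
  have h : 1 ≤ rad a b c := by
    rw [rad_def]
    exact Nat.radical_pos _
  exact_mod_cast h

/-- FIRST LEMMA OF THE LINE (tower/density split): polynomial abc below the window, lacunarity in
the window, give a good scale `R = Y`. -/
theorem sparseGoodScales_of (hP : PolyABC) (hL : RadicalLacunarity) :
    Theses.FeketeScales.SparseGoodScales := by
  intro δ hδ N
  obtain ⟨A, C, hAC⟩ := hP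
  set A' : ℝ := max A 1 with hA'
  set C' : ℝ := max C 1 with hC'
  have hA'1 : 1 ≤ A' := le_max_right _ _
  have hC'1 : 1 ≤ C' := le_max_right _ _
  have hA'pos : 0 < A' := by linarith
  have hC'0 : 0 ≤ C' := by linarith
  -- strengthened polynomial bound with `A' ≥ 1`, `C' ≥ 1`
  have hAC' : ∀ a b c : ℕ, IsABCTriple a b c → (c : ℝ) ≤ C' * ((rad a b c : ℕ) : ℝ) ^ A' := by
    intro a b c h
    have hr1 : (1 : ℝ) ≤ ((rad a b c : ℕ) : ℝ) := one_le_rad_real a b c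
    have hpow : ((rad a b c : ℕ) : ℝ) ^ A ≤ ((rad a b c : ℕ) : ℝ) ^ A' :=
      Real.rpow_le_rpow_of_exponent_le hr1 (le_max_left _ _)
    have hpow0 : 0 ≤ ((rad a b c : ℕ) : ℝ) ^ A := Real.rpow_nonneg (by positivity) _
    calc (c : ℝ) ≤ C * ((rad a b c : ℕ) : ℝ) ^ A := hAC a b c h
      _ ≤ C' * ((rad a b c : ℕ) : ℝ) ^ A := mul_le_mul_of_nonneg_right (le_max_left _ _) hpow0
      _ ≤ C' * ((rad a b c : ℕ) : ℝ) ^ A' := mul_le_mul_of_nonneg_left hpow hC'0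
  -- window exponent `l = 1/(2A')`
  set l : ℝ := 1 / (2 * A') with hl
  have hl0 : 0 < l := by positivity
  have hl1 : l < 1 := by
    rw [hl, div_lt_one (by positivity)]
    linarith
  have hlA : l * A' = 1 / 2 := by
    rw [hl]
    field_simp
  -- threshold `Y ≥ C'^2`
  obtain ⟨M, hM⟩ := exists_nat_ge (C' ^ 2)
  obtain ⟨Y, hYN, hY⟩ := hL δ hδ l hl0 hl1 (max (max N M) 1)
  refine ⟨Y, le_trans (le_trans (le_max_left _ _) (le_max_left _ _)) hYN, ?_⟩
  intro a b c h hr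
  have hY1nat : 1 ≤ Y := le_trans (le_max_right _ _) hYN
  have hY1 : (1 : ℝ) ≤ (Y : ℝ) := by exact_mod_cast hY1nat
  have hYpos : (0 : ℝ) < Y := by linarith
  have hMY : (M : ℝ) ≤ Y := by
    exact_mod_cast le_trans (le_trans (le_max_right _ _) (le_max_left _ _)) hYN
  have hYC : C' ^ 2 ≤ (Y : ℝ) := le_trans hM hMY
  have hrY : ((rad a b c : ℕ) : ℝ) ≤ (Y : ℝ) := by exact_mod_cast hr
  by_cases hwin : (Y : ℝ) ^ l < ((rad a b c : ℕ) : ℝ)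
  · -- inside the window: quality ≤ 1+δ at the radical's own scale
    have hq := hY a b c h hwin hr
    calc (c : ℝ) ≤ ((rad a b c : ℕ) : ℝ) ^ (1 + δ) := hq
      _ ≤ (Y : ℝ) ^ (1 + δ) := Real.rpow_le_rpow (by positivity) hrY (by linarith)
  · -- below the window: the polynomial bound suffices
    push Not at hwin
    have hr0 : (0 : ℝ) ≤ ((rad a b c : ℕ) : ℝ) := by positivity
    have hsqrt : C' ≤ (Y : ℝ) ^ (1 / 2 : ℝ) := by
      calc C' = Real.sqrt (C' ^ 2) := by rw [Real.sqrt_sq hC'0]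
        _ ≤ Real.sqrt Y := Real.sqrt_le_sqrt hYC
        _ = (Y : ℝ) ^ (1 / 2 : ℝ) := Real.sqrt_eq_rpow _
    calc (c : ℝ) ≤ C' * ((rad a b c : ℕ) : ℝ) ^ A' := hAC' a b c h
      _ ≤ C' * ((Y : ℝ) ^ l) ^ A' := by
          apply mul_le_mul_of_nonneg_left _ hC'0
          exact Real.rpow_le_rpow hr0 hwin hA'pos.le
      _ = C' * (Y : ℝ) ^ (1 / 2 : ℝ) := by
          rw [← Real.rpow_mul hYpos.le, hlA]
      _ ≤ (Y : ℝ) ^ (1 / 2 : ℝ) * (Y : ℝ) ^ (1 / 2 : ℝ) :=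
          mul_le_mul_of_nonneg_right hsqrt (Real.rpow_nonneg hYpos.le _)
      _ = (Y : ℝ) ^ (1 : ℝ) := by
          rw [← Real.rpow_add hYpos]
          norm_num
      _ ≤ (Y : ℝ) ^ (1 + δ) := Real.rpow_le_rpow_of_exponent_le hY1 (by linarith)

/-- CONVERSE FOR THIN TOP WINDOWS: the crux forces lacunarity of the windows `(Y^l, Y]` with
`l = (1+δ'')/(1+δ)` (any `0 < δ'' < δ`). So `RadicalLacunarity` restricted to `l` close to `1` is a
NECESSARY condition for `SparseGoodScales`; only the wide windows (`l` small) are extra, and those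
are exactly what the polynomial bound converts into good scales. -/
theorem radicalLacunarity_top_of_sparseGoodScales
    (h : Theses.FeketeScales.SparseGoodScales) :
    ∀ δ δ'' : ℝ, 0 < δ'' → δ'' < δ → ∀ N : ℕ, ∃ Y : ℕ, N ≤ Y ∧
      ∀ a b c : ℕ, IsABCTriple a b c →
        (Y : ℝ) ^ ((1 + δ'') / (1 + δ)) < ((rad a b c : ℕ) : ℝ) → rad a b c ≤ Y →
        (c : ℝ) ≤ ((rad a b c : ℕ) : ℝ) ^ (1 + δ) := by
  intro δ δ'' hδ'' hlt N
  have hδ : 0 < δ := by linarith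
  obtain ⟨Y, hYN, hY⟩ := h δ'' hδ'' (max N 1)
  refine ⟨Y, le_trans (le_max_left _ _) hYN, ?_⟩
  intro a b c habc hwin hr
  have hY1 : (1 : ℝ) ≤ (Y : ℝ) := by exact_mod_cast le_trans (le_max_right _ _) hYN
  have hYpos : (0 : ℝ) < Y := by linarith
  have hgood := hY a b c habc hr
  -- `Y^{1+δ''} = (Y^{(1+δ'')/(1+δ)})^{1+δ} < rad^{1+δ}`
  have hexp : (Y : ℝ) ^ (1 + δ'') = ((Y : ℝ) ^ ((1 + δ'') / (1 + δ))) ^ (1 + δ) := by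
    rw [← Real.rpow_mul hYpos.le]
    congr 1
    field_simp
  have hlt' : ((Y : ℝ) ^ ((1 + δ'') / (1 + δ))) ^ (1 + δ) < ((rad a b c : ℕ) : ℝ) ^ (1 + δ) :=
    Real.rpow_lt_rpow (Real.rpow_nonneg hYpos.le _) hwin (by linarith)
  calc (c : ℝ) ≤ (Y : ℝ) ^ (1 + δ'') := hgood
    _ = ((Y : ℝ) ^ ((1 + δ'') / (1 + δ))) ^ (1 + δ) := hexp
    _ ≤ ((rad a b c : ℕ) : ℝ) ^ (1 + δ) := hlt'.le

/-- A `δ`-BAD SCALE IS WITNESSED BY ONE TRIPLE (shadow calculus, B1 of the ideator's notes):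
`R` is not `δ`-good iff some triple has `rad ≤ R` and `c > R^{1+δ}`, i.e. `R` lies in the
"shadow" `[rad, c^{1/(1+δ)})` of that triple. Trivial logic, recorded for the line card. -/
theorem bad_scale_iff (δ : ℝ) (R : ℕ) :
    (¬ ∀ a b c : ℕ, IsABCTriple a b c → rad a b c ≤ R → (c : ℝ) ≤ (R : ℝ) ^ (1 + δ)) ↔
      ∃ a b c : ℕ, IsABCTriple a b c ∧ rad a b c ≤ R ∧ (R : ℝ) ^ (1 + δ) < (c : ℝ) := by
  constructor
  · intro h
    by_contra hne
    apply h
    intro a b c habc hr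
    by_contra hlt
    exact hne ⟨a, b, c, habc, hr, lt_of_not_ge hlt⟩
  · rintro ⟨a, b, c, habc, hr, hlt⟩ h
    exact absurd (h a b c habc hr) (not_le.mpr hlt)

/-- THE FIRST-MOMENT WALL (proved; barrier note B8). If for EVERY `δ > 0` the `δ`-shadow
log-lengths `(log c − (1+δ)·log rad)⁺` are summable over all abc triples, then the abc conjecture
holds outright: a `(1+2δ)`-bad triple has shadow length `≥ δ·log rad → ∞`, so summability leaves
finitely many of them for each `δ`, which is `ABC`. Hence any proof of `SparseGoodScales` by
"measure of the union of shadows < length of the tail" (union bound / exceptional-set counting)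
proves `ABC` and is not a cheaper line. -/
theorem abc_of_summable_shadows
    (h : ∀ δ : ℝ, 0 < δ →
      Summable (fun t : {t : ℕ × ℕ × ℕ // IsABCTriple t.1 t.2.1 t.2.2} =>
        max 0 (Real.log (t.1.2.2 : ℝ) - (1 + δ) * Real.log ((rad t.1.1 t.1.2.1 t.1.2.2 : ℕ) : ℝ)))) :
    _root_.ABC := by
  rw [_root_.ABC_iff]
  intro ε hε
  have ht := (h ε hε).tendsto_cofinite_zero
  have hev : ∀ᶠ t : {t : ℕ × ℕ × ℕ // IsABCTriple t.1 t.2.1 t.2.2} in Filter.cofinite,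
      max 0 (Real.log (t.1.2.2 : ℝ) - (1 + ε) * Real.log ((rad t.1.1 t.1.2.1 t.1.2.2 : ℕ) : ℝ)) < 1 :=
    ht (Iio_mem_nhds one_pos)
  rw [Filter.eventually_cofinite] at hev
  set S := hev.toFinset with hS
  have hsum0 : 0 ≤ ∑ t ∈ S, ((t.1.2.2 : ℕ) : ℝ) := Finset.sum_nonneg (fun t _ => by positivity)
  refine ⟨Real.exp 1 + ∑ t ∈ S, ((t.1.2.2 : ℕ) : ℝ), by positivity, ?_⟩
  intro a b c habc
  have hr1 : (1 : ℝ) ≤ ((rad a b c : ℕ) : ℝ) := one_le_rad_real a b c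
  have hrpos : (0 : ℝ) < ((rad a b c : ℕ) : ℝ) := by linarith
  have hrpow1 : (1 : ℝ) ≤ ((rad a b c : ℕ) : ℝ) ^ (1 + ε) := Real.one_le_rpow hr1 (by linarith)
  have hrpow0 : (0 : ℝ) ≤ ((rad a b c : ℕ) : ℝ) ^ (1 + ε) := by linarith
  have hcpos : (0 : ℝ) < (c : ℝ) := by
    have h1 : 0 < a := habc.1
    have h3 : a + b = c := habc.2.2.1
    have : 0 < c := by omega
    exact_mod_cast this
  by_cases hmem : (⟨(a, b, c), habc⟩ : {t : ℕ × ℕ × ℕ // IsABCTriple t.1 t.2.1 t.2.2}) ∈ S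
  · -- one of the finitely many exceptional triples: `c ≤ Σ < C ≤ C · rad^{1+ε}`
    have hc_le : (c : ℝ) ≤ ∑ t ∈ S, ((t.1.2.2 : ℕ) : ℝ) :=
      Finset.single_le_sum (s := S) (f := fun t : {t : ℕ × ℕ × ℕ // IsABCTriple t.1 t.2.1 t.2.2} =>
        ((t.1.2.2 : ℕ) : ℝ)) (fun t _ => by positivity) hmem
    calc (c : ℝ) < Real.exp 1 + ∑ t ∈ S, ((t.1.2.2 : ℕ) : ℝ) := by linarith [Real.exp_pos 1]
      _ = (Real.exp 1 + ∑ t ∈ S, ((t.1.2.2 : ℕ) : ℝ)) * 1 := (mul_one _).symm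
      _ ≤ (Real.exp 1 + ∑ t ∈ S, ((t.1.2.2 : ℕ) : ℝ)) * ((rad a b c : ℕ) : ℝ) ^ (1 + ε) :=
          mul_le_mul_of_nonneg_left hrpow1 (by positivity)
  · -- generic triple: its `ε`-shadow term is `< 1`, i.e. `c < e · rad^{1+ε}`
    have hP : max 0 (Real.log (c : ℝ) - (1 + ε) * Real.log ((rad a b c : ℕ) : ℝ)) < 1 := by
      by_contra hn
      exact hmem (hev.mem_toFinset.mpr hn)
    have hX : Real.log (c : ℝ) - (1 + ε) * Real.log ((rad a b c : ℕ) : ℝ) < 1 :=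
      lt_of_le_of_lt (le_max_right _ _) hP
    have hlog : Real.log (c : ℝ) < 1 + Real.log ((rad a b c : ℕ) : ℝ) * (1 + ε) := by linarith
    have hc : (c : ℝ) < Real.exp 1 * ((rad a b c : ℕ) : ℝ) ^ (1 + ε) := by
      calc (c : ℝ) = Real.exp (Real.log (c : ℝ)) := (Real.exp_log hcpos).symm
        _ < Real.exp (1 + Real.log ((rad a b c : ℕ) : ℝ) * (1 + ε)) := Real.exp_lt_exp.mpr hlog
        _ = Real.exp 1 * ((rad a b c : ℕ) : ℝ) ^ (1 + ε) := by
            rw [Real.exp_add, Real.rpow_def_of_pos hrpos]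
    calc (c : ℝ) < Real.exp 1 * ((rad a b c : ℕ) : ℝ) ^ (1 + ε) := hc
      _ ≤ (Real.exp 1 + ∑ t ∈ S, ((t.1.2.2 : ℕ) : ℝ)) * ((rad a b c : ℕ) : ℝ) ^ (1 + ε) :=
          mul_le_mul_of_nonneg_right (by linarith) hrpow0

end Summit.ABC.ABC.Cruxes.SparseGoodScales.RadicalLacunaritySplit
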